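import Summits.CriticalPhenomena.PercolationContinuityZ3.Theorems.PercNearOneGluingNoHeavyConstsSingleEdgeVClass
import Summits.CriticalPhenomena.PercolationContinuityZ3.Theorems.PercNearOneGluingNoHeavyConstsSingleEdgeChainRuleSEE
import Summits.CriticalPhenomena.PercolationContinuityZ3.Theorems.PercNearOneGluingAdditiveGluingCSHUpperSets
import HarnessLib

/-!
# Single-edge extremality holds against every competitor supported on `{v ∈ C_x} ∪ {o ∈ C_x}` (PAPER-2 track (ii): CSH constants)

builds on p205010 (kernel theorem, internal audit signed; external expert review pending).  Support file (`--supports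
stmt-CriticalPhenomena-4575`), seat `prim-consts-2` (gen 3); rows A6/A11 of `run/shared/lean/prim/consts/CONSTANTS.md`; memo
`run/shared/lean/prim/consts/FROM-prim-consts-2-g3-CHAIN-RULE.md`.  No definitions, no sorries; standard axioms.

`Consts.singleEdge_margin_nonneg_of_support` (p246519) proves the conjecture SEE (`Consts.SingleEdgeExtremal`) for monotone functionals
vanishing on clusters that do not contain `v`; `Consts.singleEdge_margin_nonneg_of_saturated` (p247594) for functionals saturated on
`{v ∈ C_x}`.  Here the first class is enlarged:

* `Consts.singleEdge_margin_nonneg_of_support_union` — **THEOREM.**  For every finite weighted graph, owner `x`, observers `o` and `v ≠ x`,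
  avoided set `Y`, and every monotone `f` that VANISHES ON CLUSTERS CONTAINING NEITHER `v` NOR `o` (no pair of the cluster contains `v`
  and none contains `o` ⟹ `f = 0`), the level-0 margin at the single-pair value `p⋆` is nonnegative:
  `covD(f, v)·[μ(D)μ(D₁∩O) − μ(D₁)μ(D∩{x↔o})] ≤ covD(f, o)·[μ(D₁)μ(D∩{x↮v})]`.
  So a functional violating SEE must charge a cluster avoiding BOTH observers — the part of the cluster lattice where the session's
  partition-law barrier (memo §5) lives.  Proof: split `f = f·1{v ∈ V(C)} + g`; the first piece is p246519; the remainder `g ≥ 0` is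
  supported on `{o ∈ V(C), v ∉ V(C)}`, where `covD(g, v) = −(∫_D g) μ(D ∩ {x↔v}) ≤ 0` and `covD(g, o) = (∫_D g)(μ(D) − μ(D ∩ {x↔o})) ≥ 0`,
  and the bracket `R = μ(D)μ(D₁∩O) − μ(D₁)μ(D∩{x↔o})` is `≥ 0` by source monotonicity (`Consts.real_reach_avoid_insert_ge`).
[cite: VandenbergHaggstromKahn2005, Thm. 1.3 (p. 6), Thm. 1.4 (p. 7) with Remark 1 after Thm. 1.2 (p. 5)]
-/

noncomputable section

namespace Summit.CriticalPhenomena.PercolationContinuityZ3.Theorems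

open MeasureTheory Set Literature.Probability.LatticeModels Literature.Probability.Percolation
open scoped Classical

namespace Consts

variable {V : Type*} [Fintype V]

/-- **SEE against competitors supported on `{v ∈ V(𝐂_x)} ∪ {o ∈ V(𝐂_x)}`.**  For a monotone `f` with `f(C) = 0` whenever no pair of `C`
contains `v` and no pair of `C` contains `o` (`x ≠ v`), the single-edge-extremality margin (the inequality of `Consts.SingleEdgeExtremal`)
is nonnegative at `f`. [cite: VandenbergHaggstromKahn2005, Thm. 1.3 (p. 6), Thm. 1.4 (p. 7)] -/
theorem singleEdge_margin_nonneg_of_support_union (w : Sym2 V → unitInterval) (x o v : V) (Y : Set V) (hxv : x ≠ v)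
    (f : Set (Sym2 V) → ℝ) (hf : Monotone f)
    (hfs : ∀ C : Set (Sym2 V), (∀ d ∈ C, v ∉ d) → (∀ d ∈ C, o ∉ d) → f C = 0) :
    CSH.covD w x Y f v *
        ((prodBernoulli w).real {ω : BondConfig V | ∀ y ∈ Y, ¬ (openGraph ω).Reachable x y} *
            (prodBernoulli w).real
              ({ω : BondConfig V | ∀ y ∈ Y, ¬ (openGraph ω).Reachable x y ∧ ¬ (openGraph ω).Reachable v y} ∩
                (openConn x o ∪ openConn v o)) -
          (prodBernoulli w).real
              {ω : BondConfig V | ∀ y ∈ Y, ¬ (openGraph ω).Reachable x y ∧ ¬ (openGraph ω).Reachable v y} *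
            (prodBernoulli w).real ({ω : BondConfig V | ∀ y ∈ Y, ¬ (openGraph ω).Reachable x y} ∩ openConn x o)) ≤
      CSH.covD w x Y f o *
        ((prodBernoulli w).real
            {ω : BondConfig V | ∀ y ∈ Y, ¬ (openGraph ω).Reachable x y ∧ ¬ (openGraph ω).Reachable v y} *
          (prodBernoulli w).real
            ({ω : BondConfig V | ∀ y ∈ Y, ¬ (openGraph ω).Reachable x y} ∩ {ω | ¬ (openGraph ω).Reachable x v})) := by
  classical
  set μ := prodBernoulli w with hμ
  have hmeas : ∀ T : Set (BondConfig V), MeasurableSet T := fun _ => MeasurableSet.of_discrete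
  set D : Set (BondConfig V) := {ω | ∀ y ∈ Y, ¬ (openGraph ω).Reachable x y} with hD
  set D₁ : Set (BondConfig V) := {ω | ∀ y ∈ Y, ¬ (openGraph ω).Reachable x y ∧ ¬ (openGraph ω).Reachable v y} with hD₁
  set O : Set (BondConfig V) := openConn x o ∪ openConn v o with hO
  set N : Set (BondConfig V) := {ω | ¬ (openGraph ω).Reachable x v} with hN
  set R : ℝ := μ.real D * μ.real (D₁ ∩ O) - μ.real D₁ * μ.real (D ∩ openConn x o) with hR
  set M : ℝ := μ.real D₁ * μ.real (D ∩ N) with hM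
  -- `f ≥ 0`
  have hf0 : f ∅ = 0 := hfs ∅ (fun d hd => absurd hd (Set.notMem_empty d)) (fun d hd => absurd hd (Set.notMem_empty d))
  have hfnn : ∀ C, 0 ≤ f C := fun C => by rw [← hf0]; exact hf (Set.empty_subset C)
  -- split `f = fB + g`
  set fB : Set (Sym2 V) → ℝ := fun C => if (∃ d ∈ C, v ∈ d) then f C else 0 with hfB
  set g : Set (Sym2 V) → ℝ := fun C => if (∃ d ∈ C, v ∈ d) then 0 else f C with hg
  have hsplit : f = fB + g := by
    funext C; simp only [hfB, hg, Pi.add_apply]; split_ifs <;> simp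
  have hfBm : Monotone fB := by
    intro C C' hCC'
    simp only [hfB]
    by_cases h : ∃ d ∈ C, v ∈ d
    · obtain ⟨d, hd, hvd⟩ := h
      rw [if_pos ⟨d, hd, hvd⟩, if_pos ⟨d, hCC' hd, hvd⟩]; exact hf hCC'
    · rw [if_neg h]; split_ifs
      · exact hfnn C'
      · exact le_rfl
  have hfBs : ∀ C : Set (Sym2 V), (∀ d ∈ C, v ∉ d) → fB C = 0 := fun C hC => by
    simp only [hfB]; rw [if_neg]; push Not; exact hC
  have hgnn : ∀ C, 0 ≤ g C := fun C => by simp only [hg]; split_ifs; exacts [le_rfl, hfnn C]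
  have hg_v : ∀ C : Set (Sym2 V), (∃ d ∈ C, v ∈ d) → g C = 0 := fun C hC => by simp only [hg]; rw [if_pos hC]
  have hg_o : ∀ C : Set (Sym2 V), (∀ d ∈ C, o ∉ d) → g C = 0 := fun C hC => by
    simp only [hg]; split_ifs with h
    · rfl
    · push Not at h; exact hfs C h hC
  -- K2 for `fB`
  have key := singleEdge_margin_nonneg_of_support w x o v Y fB hfBm hfBs
  -- the remainder `g`, read on configurations
  set G : BondConfig V → ℝ := fun ω => g (openEdgeCluster ω x) with hG
  have hG_v : ∀ ω : BondConfig V, (openGraph ω).Reachable x v → G ω = 0 := by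
    intro ω hr
    rcases (reachable_iff_exists_mem_openEdgeCluster ω x v).1 hr with h | ⟨e, he, hve⟩
    · exact absurd h.symm hxv
    · exact hg_v _ ⟨e, he, hve⟩
  have hG_o : ∀ ω : BondConfig V, ¬ (openGraph ω).Reachable x o → G ω = 0 := by
    intro ω hr
    refine hg_o _ (fun d hd hod => hr ?_)
    exact (reachable_iff_exists_mem_openEdgeCluster ω x o).2 (Or.inr ⟨d, hd, hod⟩)
  set Gint : ℝ := ∫ ω in D, G ω ∂μ with hGint_def
  have hGint : 0 ≤ Gint := by rw [hGint_def]; exact setIntegral_nonneg (hmeas D) (fun ω _ => hgnn _)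
  have i1 : ∫ ω in D ∩ openConn x v, G ω ∂μ = 0 := by
    refine setIntegral_eq_zero_of_forall_eq_zero (fun ω hω => hG_v ω ?_)
    exact hω.2
  have i2 : ∫ ω in D ∩ openConn x o, G ω ∂μ = Gint := by
    rw [hGint_def, ← integral_indicator (hmeas _), ← integral_indicator (hmeas D)]
    refine integral_congr_ae (Filter.Eventually.of_forall fun ω => ?_)
    by_cases hω : ω ∈ D
    · by_cases hr : (openGraph ω).Reachable x o
      · rw [indicator_of_mem (show ω ∈ D ∩ openConn x o from ⟨hω, hr⟩), indicator_of_mem hω]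
      · rw [indicator_of_notMem (fun h : ω ∈ D ∩ openConn x o => hr h.2), indicator_of_mem hω, hG_o ω hr]
    · rw [indicator_of_notMem (fun h : ω ∈ D ∩ openConn x o => hω h.1), indicator_of_notMem hω]
  have cgv : CSH.covD w x Y g v = -(Gint * μ.real (D ∩ openConn x v)) := by
    unfold CSH.covD; rw [i1, ← hGint_def]; ring
  have cgo : CSH.covD w x Y g o = Gint * (μ.real D - μ.real (D ∩ openConn x o)) := by
    unfold CSH.covD; rw [i2, ← hGint_def]; ring
  -- signs of the brackets
  have hRnn : 0 ≤ R := by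
    have h := real_reach_avoid_insert_ge w {x} Y v o
    have e1 : {ω : BondConfig V | ∀ s ∈ ({x} : Set V), ∀ y ∈ Y, ¬ (openGraph ω).Reachable s y} = D := by
      ext ω; simp only [mem_setOf_eq, mem_singleton_iff, forall_eq, hD]
    have e2 : {ω : BondConfig V | ∀ s ∈ insert v ({x} : Set V), ∀ y ∈ Y, ¬ (openGraph ω).Reachable s y} = D₁ := by
      ext ω; simp only [mem_setOf_eq, mem_insert_iff, mem_singleton_iff, forall_eq_or_imp, forall_eq, hD₁]
      exact ⟨fun h y hy => ⟨h.2 y hy, h.1 y hy⟩, fun h => ⟨fun y hy => (h y hy).2, fun y hy => (h y hy).1⟩⟩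
    have e3 : {ω : BondConfig V | ∃ s ∈ ({x} : Set V), (openGraph ω).Reachable s o} = openConn x o := by
      ext ω; simp only [mem_setOf_eq, mem_singleton_iff, exists_eq_left, openConn]
    have e4 : {ω : BondConfig V | ∃ s ∈ insert v ({x} : Set V), (openGraph ω).Reachable s o} = O := by
      ext ω; simp only [mem_setOf_eq, mem_insert_iff, mem_singleton_iff, exists_eq_or_imp, exists_eq_left, hO, mem_union, openConn]
      exact Or.comm
    rw [e1, e2, e3, e4] at h
    -- h : μ.real (D ∩ openConn x o) * μ.real D₁ ≤ μ.real (D₁ ∩ O) * μ.real D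
    rw [hR]; nlinarith [h]
  have hMnn : 0 ≤ M := mul_nonneg measureReal_nonneg measureReal_nonneg
  have hDA : μ.real (D ∩ openConn x o) ≤ μ.real D := measureReal_mono inter_subset_left
  have hDB : 0 ≤ μ.real (D ∩ openConn x v) := measureReal_nonneg
  -- assemble
  have hv : CSH.covD w x Y f v = CSH.covD w x Y fB v + CSH.covD w x Y g v := by
    rw [hsplit, CSH.covD_add]; rfl
  have ho : CSH.covD w x Y f o = CSH.covD w x Y fB o + CSH.covD w x Y g o := by
    rw [hsplit, CSH.covD_add]; rfl
  rw [hv, ho, cgv, cgo]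
  have t1 : -(Gint * μ.real (D ∩ openConn x v)) * R ≤ 0 := by
    have : 0 ≤ Gint * μ.real (D ∩ openConn x v) * R := mul_nonneg (mul_nonneg hGint hDB) hRnn
    linarith
  have t2 : 0 ≤ Gint * (μ.real D - μ.real (D ∩ openConn x o)) * M := mul_nonneg (mul_nonneg hGint (by linarith)) hMnn
  nlinarith [key, t1, t2]

end Consts

end Summit.CriticalPhenomena.PercolationContinuityZ3.Theorems

end
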